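import Literature.NumberTheory.LFunctions.MertensSecondChainSound
import Literature.NumberTheory.LFunctions.MertensErrorTermsMeanValueRH
import HarnessLib

/-!
# RH-FREE kernel certificate — «nothing here bears on the truth of RH»
# The error term of Mertens' third theorem is positive below `358 811`:
# `e^γ log x ∏_{p ≤ x} (1 − 1/p) < 1` for `2 ≤ x < 358811` (`Zhao2025.E₃_pos_of_lt`)

Topic: `Literature/NumberTheory/LFunctions`. Rosser–Schoenfeld (Illinois J. Math. 6 (1962), Thm 23 and p. 87) record
that `∏_{p ≤ x} (1 − 1/p) < e^{−γ}/log x` for `0 < x ≤ 10⁸`, i.e. the error term of Mertens' third theorem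
`E₃(x) = (log x)⁻¹ ∏_{p ≤ x}(1 − 1/p)⁻¹ − e^γ` (`Zhao2025.E₃`) is POSITIVE there; T. Zhao (Res. Number Theory 11 (2025) 62,
§1.1, §4) uses it as the numerical input of the first clause of his Theorem 2 («if `Θ = 1/2` then `∫₂^X E₃(x) dx > 0`
for all `X > 2`»). This file is a kernel certificate of `E₃(x) > 0` on the initial range `2 ≤ x < 358811` — the range
below the explicit threshold `X₁ = 358801` of `MertensErrorTermsMeanValueRHThm2LargeX.lean`. It is the twin of the
`E₂`-certificate `MertensSecondChainCheck/Sound/Run1.lean` / `MertensSecondErrorPositive.lean`, walking the complete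
prime table `ChainTable.table` (`ChainTableFacts.tableOK`) with the same state type `MertensSecondChain.ES`:

* §1 (computable core, nothing asserted) `step`/`run`/`runD`/`init3`/`GHI`: a state `⟨p, Llo, Lhi, LL, S⟩` carries
  `Llo ≤ 2⁸⁰ log p ≤ Lhi`, `2⁸⁰ log log p ≤ LL` (exactly as in the `E₂`-chain) and a LOWER bound
  `S ≤ 2⁸⁰ Σ_{q ≤ p} log(q/(q−1))`; a step to the table successor `p'` certifies its primality (`ThetaChain.primeChk`),
  extends the enclosures (`ThetaChain.logNext`, `ChainCheck.lnp`), performs THE comparison `GHI + LL' ≤ S`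
  (`γ < GHI/2⁸⁰`, `EulerMascheroniBounds`), which gives `Σ_{q ≤ x} log(q/(q−1)) > γ + log log x` on `[p, p')`, and adds
  the lower enclosure of `2⁸⁰ log(1 + 1/(p'−1))` (`lnp 1 (p'−1)`);
* §2 the kernel facts `run1`/`run2` (`decide +kernel`, two chunks of `15333` steps, primes `3 → 167953 → 358811`);
* §3 soundness: the invariant `Inv`, `step_inv`, `run_sound`, `init3_inv` (`Σ_{q ≤ 3} log(q/(q−1)) = log 3`);
* §4 **`Zhao2025.E₃_pos_of_lt`**: `E₃(x) > 0` for every real `2 ≤ x < 358811` (on `[3, 358811)` from the chain, since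
  `∏_{q ≤ x}(1 − 1/q)⁻¹ = exp Σ_{q ≤ x} log(q/(q−1)) > e^γ log x`; on `[2, 3)` by hand: `2 > e^γ log 3`).

Standard axioms (`decide +kernel`, no `native_decide`). Nothing here concerns RH.

## References
* J. B. Rosser, L. Schoenfeld, Illinois J. Math. 6 (1962), 64–94, Thm 23 and p. 87. [RosserSchoenfeld1962]
* T. Zhao, Res. Number Theory 11 (2025) 62, §1.1, §4 (Thm 2). [Zhao2025MertensMean]
-/

namespace Literature.NumberTheory.LFunctions

namespace MertensThirdChain

open ChainCheck ChainTable ThetaChain MertensSecondChain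

/-! ### §1 The computable core -/

/-- `GHI`: `2⁸⁰ γ < GHI` (`GHI/2⁸⁰ = 0.57721571…`, `γ = 0.57721566…`). [folklore] -/
def GHI : ℕ := 697810975306190105464740

/-- **One step** of the Mertens-III chain to the next table entry `p'`: order, parity, primality; the new enclosures of
`log p'`, `log log p'`; THE comparison `GHI + LL' ≤ S` (positivity of `E₃` on `[p, p')`); the new lower sum
`S' = S + lo(2⁸⁰ log(1 + 1/(p'−1)))`. [folklore] -/
def step (s : ES) (p' : ℕ) : Option ES :=
  match s with
  | ⟨p, Llo, Lhi, LL, S⟩ =>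
    bif !(Nat.blt p p' && Nat.beq (Nat.mod p' 2) 1 && primeChk p') then none else
    match logNext p Llo Lhi p' with
    | none => none
    | some (Llo', Lhi') =>
      let d := Nat.sub Lhi' Llo
      bif !(Nat.blt 0 Llo' && Nat.ble Llo Lhi' && Nat.ble (Nat.mul 2 d) Llo) then none else
      match lnp d Llo with
      | (_, dhi) =>
        let LL' := Nat.add LL dhi
        match lnp 1 (Nat.sub p' 1) with
        | (tlo, _) =>
          bif !(Nat.ble (Nat.add GHI LL') S) then none
          else some ⟨p', Llo', Lhi', LL', Nat.add S tlo⟩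

/-- Run over a segment of the table with fuel (a chunk). [folklore] -/
def run : ℕ → ES → List ℕ → Option ES
  | 0, s, _ => some s
  | _ + 1, s, [] => some s
  | fuel + 1, s, p' :: rest =>
    match step s p' with
    | none => none
    | some s' => run fuel s' rest

/-- **A chunk of the run**: at most `fuel` table entries after the state's prime. [folklore] -/
def runD (fuel : ℕ) (s : ES) : Option ES := run fuel s (ChainCheck.after s.p table)

/-- The initial state at `p = 3`: the enclosures of `log 3` and `log log 3` of `MertensSecondChain.initE`, and
`S₃ = lo(2⁸⁰ log 3)` since `Σ_{q ≤ 3} log(q/(q−1)) = log 2 + log(3/2) = log 3`. [folklore] -/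
def init3 : ES :=
  ⟨3, 1328140761516560292552947, 1328140761517035898327275, 113696847084947482087084,
    1328140761516560292552947⟩

/-! ### §2 The kernel facts -/

set_option maxHeartbeats 0 in
/-- **Chunk 1 of the certified Mertens-III run** (primes `3` to `167953`). [cite: Zhao2025MertensMean, §1.1 («E_i(x) > 0 for 2 ≤ x ≤ 10⁸» [RS])] -/
theorem run1 :
    runD 15333 init3 =
    some ⟨167953, 14545117807108278801555194, 14545117807108754407928708,
        3007230998018183245836188, 3705232068526178659298518⟩ := by
  decide +kernel

set_option maxHeartbeats 0 in
/-- **Chunk 2 of the certified Mertens-III run** (primes `167953` to `358811`). [cite: Zhao2025MertensMean, §1.1 («E_i(x) > 0 for 2 ≤ x ≤ 10⁸» [RS])] -/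
theorem run2 :
    runD 15333
      ⟨167953, 14545117807108278801555194, 14545117807108754407928708,
        3007230998018183245836188, 3705232068526178659298518⟩ =
    some ⟨358811, 15462827431324419163683070, 15462827431324894770484816,
        3081197337989921023099944, 3779223283082173560324696⟩ := by
  decide +kernel

end MertensThirdChain

end Literature.NumberTheory.LFunctions

/-! ### §3 Soundness -/

noncomputable section

namespace Literature.NumberTheory.LFunctions

open Literature.Analysis.SpecialFunctions

namespace MertensThirdChain

open ChainCheck ChainTable ThetaChain Real Finset Mertens MertensSecondChain

/-- The Mertens-III sum `Σ_{q ≤ x} log((1 − 1/q)⁻¹)` is constant on `[p, p')` when there is no prime in `(p, p')`.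
[folklore] -/
private theorem sum_real_eq {p p' : ℕ} (hq : ∀ q : ℕ, p < q → q < p' → ¬ q.Prime) {x : ℝ}
    (hpx : (p : ℝ) ≤ x) (hxp : x < p') :
    ∑ q ∈ Nat.primesLE ⌊x⌋₊, Real.log ((1 - (q : ℝ)⁻¹)⁻¹) = ∑ q ∈ Nat.primesLE p, Real.log ((1 - (q : ℝ)⁻¹)⁻¹) := by
  have hx0 : 0 ≤ x := le_trans (Nat.cast_nonneg p) hpx
  have h1 : p ≤ ⌊x⌋₊ := Nat.le_floor hpx
  have h2 : ⌊x⌋₊ < p' := (Nat.floor_lt hx0).2 hxp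
  exact MertensChain.sum_primesLE_eq_of_noPrime _ h1 fun q hq1 hq2 => hq q hq1 (by omega)

/-- At a prime `q`: `log((1 − 1/q)⁻¹) = log(1 + 1/(q − 1))`. [folklore] -/
private theorem log_term_eq {q : ℕ} (hq : q.Prime) :
    Real.log ((1 - (q : ℝ)⁻¹)⁻¹) = Real.log (1 + (1 : ℝ) / ((q : ℝ) - 1)) := by
  have hq2 : (2 : ℝ) ≤ q := by exact_mod_cast hq.two_le
  have hq0 : (q : ℝ) ≠ 0 := by positivity
  have hq1 : (q : ℝ) - 1 ≠ 0 := by linarith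
  have e1 : 1 - (q : ℝ)⁻¹ = ((q : ℝ) - 1) / q := by field_simp
  have e2 : 1 + 1 / ((q : ℝ) - 1) = (q : ℝ) / ((q : ℝ) - 1) := by field_simp; ring
  rw [e1, inv_div, e2]

/-- **The invariant** of a state of the Mertens-III chain (relative to the table `ChainTable.table`).
[cite: Zhao2025MertensMean, §1.1 («E_i(x) > 0 for 2 ≤ x ≤ 10⁸» [RS])] -/
structure Inv (s : ES) : Prop where
  /-- the prime reached is a table entry -/
  mem : s.p ∈ table
  /-- and is prime -/
  prime : s.p.Prime
  /-- and is at least `3` -/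
  three_le : 3 ≤ s.p
  /-- `0 < Llo` -/
  Llo_pos : 0 < s.Llo
  /-- `Llo ≤ 2⁸⁰ log p` -/
  Llo_le : (s.Llo : ℝ) ≤ 2 ^ 80 * Real.log s.p
  /-- `2⁸⁰ log p ≤ Lhi` -/
  le_Lhi : 2 ^ 80 * Real.log s.p ≤ s.Lhi
  /-- `2⁸⁰ log log p ≤ LL` -/
  loglog_le : 2 ^ 80 * Real.log (Real.log s.p) ≤ s.LL
  /-- `S ≤ 2⁸⁰ Σ_{q ≤ p} log((1 − 1/q)⁻¹)` -/
  S_le : (s.S : ℝ) ≤ 2 ^ 80 * ∑ q ∈ Nat.primesLE s.p, Real.log ((1 - (q : ℝ)⁻¹)⁻¹)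
  /-- the claim below `p` -/
  claim : ∀ x : ℝ, 3 ≤ x → x < s.p →
    (GHI : ℝ) / 2 ^ 80 + Real.log (Real.log x) < ∑ q ∈ Nat.primesLE ⌊x⌋₊, Real.log ((1 - (q : ℝ)⁻¹)⁻¹)

/-- **Soundness of one step.** [cite: Zhao2025MertensMean, §1.1 («E_i(x) > 0 for 2 ≤ x ≤ 10⁸» [RS])] -/
theorem step_inv {s s' : ES} (hI : Inv s) {p' : ℕ} {rest : List ℕ}
    (hafter : after s.p table = p' :: rest) (h : step s p' = some s') : Inv s' ∧ s'.p = p' := by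
  have hT := tableOK
  obtain ⟨p, Llo, Lhi, LL, S⟩ := s
  simp only at hafter hI
  obtain ⟨hmem, hprime, h3, hLlo0, hLlo, hLhi, hLL, hS, hclaim⟩ := hI
  simp only at hmem hprime h3 hLlo0 hLlo hLhi hLL hS hclaim
  -- the successor `p'`
  obtain ⟨hp'T, hpp', hmin⟩ := head_after hT.sorted hafter
  have hp'le : p' ≤ 4599989 := hT.bounded p' hp'T
  have hnoprime : ∀ q : ℕ, p < q → q < p' → ¬ q.Prime := fun q h1 h2 hq =>
    absurd (hmin q (hT.complete q hq (by omega)) h1) (not_le.2 h2)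
  have hp0 : 0 < p := hprime.pos
  -- unfold the step
  simp only [step, Nat.mul_eq, Nat.sub_eq, Nat.add_eq] at h
  obtain ⟨hg1, h⟩ := bif_not_none h
  simp only [Bool.and_eq_true] at hg1
  obtain ⟨⟨-, hodd⟩, hchk⟩ := hg1
  have hodd' : Odd p' := Nat.odd_iff.2 (Nat.eq_of_beq_eq_true hodd)
  have hp'prime : p'.Prime := primeChk_sound hchk hodd' (by omega)
  rcases hln : logNext p Llo Lhi p' with _ | ⟨Llo', Lhi'⟩
  · rw [hln] at h; simp at h
  · rw [hln] at h
    simp only at h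
    obtain ⟨hg2, h⟩ := bif_not_none h
    simp only [Bool.and_eq_true, Nat.blt_eq, Nat.ble_eq] at hg2
    obtain ⟨⟨hLlo'0, hLloLhi'⟩, h2d⟩ := hg2
    rcases hlnp : lnp (Lhi' - Llo) Llo with ⟨dlo, dhi⟩
    rw [hlnp] at h
    simp only at h
    rcases hlnp1 : lnp 1 (p' - 1) with ⟨tlo, thi⟩
    rw [hlnp1] at h
    simp only at h
    obtain ⟨hg3, h⟩ := bif_not_none h
    simp only [Nat.ble_eq] at hg3
    simp only [Option.some.injEq] at h
    subst h
    -- the new enclosures of `log p'`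
    obtain ⟨hLlo', hLhi'⟩ := logNext_sound hln hp0 hpp'.le hLlo hLhi
    have hp'R1 : (1 : ℝ) < p' := by exact_mod_cast hp'prime.one_lt
    have hpR1 : (1 : ℝ) < p := by
      have : (3 : ℝ) ≤ p := by exact_mod_cast h3
      linarith
    have hlogp : 0 < Real.log (p : ℝ) := Real.log_pos hpR1
    have hlogp' : 0 < Real.log (p' : ℝ) := Real.log_pos hp'R1
    have h80 : (0 : ℝ) < 2 ^ 80 := by positivity
    -- `log log p' ≤ (LL + dhi)/2⁸⁰`
    have hLlo0R : (0 : ℝ) < Llo := by exact_mod_cast hLlo0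
    have hdR : ((Lhi' - Llo : ℕ) : ℝ) = (Lhi' : ℝ) - Llo := by push_cast [Nat.cast_sub hLloLhi']; ring
    have hlnps := lnp_sound (p := Lhi' - Llo) (q := Llo) hLlo0 h2d
    rw [hlnp] at hlnps
    obtain ⟨-, hdhi⟩ := hlnps
    rw [hdR] at hdhi
    have hLLnew : 2 ^ 80 * Real.log (Real.log (p' : ℝ)) ≤ ((LL + dhi : ℕ) : ℝ) := by
      have e1 : Real.log (Real.log (p' : ℝ)) ≤ Real.log ((Lhi' : ℝ) / 2 ^ 80) :=
        Real.log_le_log hlogp' (by rw [le_div_iff₀ h80]; linarith)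
      have e2 : Real.log ((Llo : ℝ) / 2 ^ 80) ≤ Real.log (Real.log (p : ℝ)) :=
        Real.log_le_log (by positivity) (by rw [div_le_iff₀ h80]; linarith)
      have e3 : Real.log ((Lhi' : ℝ) / 2 ^ 80) - Real.log ((Llo : ℝ) / 2 ^ 80) =
          Real.log (1 + ((Lhi' : ℝ) - Llo) / Llo) := by
        have hLhi'0 : (0 : ℝ) < Lhi' := by exact_mod_cast hLlo'0.trans_le (by
          have : (Llo' : ℝ) ≤ Lhi' := by linarith
          exact_mod_cast this)
        rw [Real.log_div hLhi'0.ne' h80.ne', Real.log_div hLlo0R.ne' h80.ne',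
          show 1 + ((Lhi' : ℝ) - Llo) / Llo = (Lhi' : ℝ) / Llo by field_simp; ring,
          Real.log_div hLhi'0.ne' hLlo0R.ne']
        ring
      push_cast
      nlinarith [e1, e2, e3, hdhi, hLL]
    -- the new sum: `Σ_{q ≤ p'} = Σ_{q ≤ p} + log(1 + 1/(p'−1))`, `tlo ≤ 2⁸⁰ log(1 + 1/(p'−1))`
    have hsum' : ∑ q ∈ Nat.primesLE p', Real.log ((1 - (q : ℝ)⁻¹)⁻¹) =
        (∑ q ∈ Nat.primesLE p, Real.log ((1 - (q : ℝ)⁻¹)⁻¹)) + Real.log ((1 - (p' : ℝ)⁻¹)⁻¹) :=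
      MertensChain.sum_primesLE_succ_prime (fun q : ℕ => Real.log ((1 - (q : ℝ)⁻¹)⁻¹)) hp'prime hpp' hnoprime
    have htlo : (tlo : ℝ) ≤ 2 ^ 80 * Real.log ((1 - (p' : ℝ)⁻¹)⁻¹) := by
      have hq0 : 0 < p' - 1 := by omega
      have hq2 : 2 * 1 ≤ p' - 1 := by omega
      obtain ⟨hlo, -⟩ := lnp_sound (p := 1) hq0 hq2
      rw [hlnp1] at hlo
      have hcast : ((p' - 1 : ℕ) : ℝ) = (p' : ℝ) - 1 := by
        rw [Nat.cast_sub (by omega)]; norm_num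
      rw [hcast, Nat.cast_one] at hlo
      rw [log_term_eq hp'prime]
      exact hlo
    refine ⟨⟨hp'T, hp'prime, by simp only; omega, hLlo'0, hLlo', hLhi', hLLnew, ?_, ?_⟩, rfl⟩
    · -- `S + tlo ≤ 2⁸⁰ Σ_{q ≤ p'}`
      push_cast
      rw [hsum']
      linarith
    · -- the claim below `p'`
      intro x hx3 hxp'
      simp only at hxp'
      rcases lt_or_ge x p with hxp | hxp
      · exact hclaim x hx3 hxp
      · have hx0 : 0 < x := by linarith
        have hlogx : 0 < Real.log x := Real.log_pos (by linarith)
        have hrs := sum_real_eq hnoprime hxp hxp'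
        have hll : Real.log (Real.log x) < Real.log (Real.log (p' : ℝ)) :=
          Real.log_lt_log hlogx (Real.log_lt_log hx0 hxp')
        have hg3R : ((GHI : ℝ) + ((LL + dhi : ℕ) : ℝ)) ≤ S := by exact_mod_cast hg3
        rw [hrs]
        have hS' : (S : ℝ) / 2 ^ 80 ≤ ∑ q ∈ Nat.primesLE p, Real.log ((1 - (q : ℝ)⁻¹)⁻¹) := by
          rw [div_le_iff₀ h80]; linarith
        have hLL' : Real.log (Real.log (p' : ℝ)) ≤ ((LL + dhi : ℕ) : ℝ) / 2 ^ 80 := by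
          rw [le_div_iff₀ h80]; linarith
        have : (GHI : ℝ) / 2 ^ 80 + ((LL + dhi : ℕ) : ℝ) / 2 ^ 80 ≤ (S : ℝ) / 2 ^ 80 := by
          rw [← add_div]; exact div_le_div_of_nonneg_right hg3R h80.le
        linarith

/-- **Soundness of a run** along the table cursor. [cite: Zhao2025MertensMean, §1.1 («E_i(x) > 0 for 2 ≤ x ≤ 10⁸» [RS])] -/
theorem run_sound : ∀ (fuel : ℕ) {s s' : ES}, Inv s → run fuel s (after s.p table) = some s' → Inv s'
  | 0, s, s', hI, h => by
      simp only [run, Option.some.injEq] at h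
      exact h ▸ hI
  | fuel + 1, s, s', hI, h => by
      rcases hseg : after s.p table with _ | ⟨p', rest⟩
      · rw [hseg] at h
        simp only [run, Option.some.injEq] at h
        exact h ▸ hI
      · rw [hseg] at h
        simp only [run] at h
        rcases hst : step s p' with _ | s₁
        · rw [hst] at h; simp at h
        · rw [hst] at h
          simp only at h
          obtain ⟨hI₁, hp₁⟩ := step_inv hI hseg hst
          have hrest : rest = after s₁.p table := by
            rw [hp₁]; exact tail_after tableOK.sorted hseg
          rw [hrest] at h
          exact run_sound fuel hI₁ h

/-- **Soundness of a chunk**: `runD` preserves the invariant. [cite: Zhao2025MertensMean, §1.1 («E_i(x) > 0 for 2 ≤ x ≤ 10⁸» [RS])] -/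
theorem runD_sound {fuel : ℕ} {s s' : ES} (hI : Inv s) (h : runD fuel s = some s') : Inv s' :=
  run_sound fuel hI h

/-- `logIv 3` (kernel). [folklore] -/
private theorem logIv_three :
    KernelLog.logIv 3 = some (1328140761516560292552947, 1328140761517035898327275) := by
  decide +kernel

/-- **The initial state (the prime `3`) satisfies the invariant** (its `log`/`log log` enclosures are those of
`MertensSecondChain.initE`, certified by `MertensSecondChain.initE_inv`; `Σ_{q ≤ 3} log((1 − 1/q)⁻¹) = log 3`).
[cite: Zhao2025MertensMean, §1.1 («E_i(x) > 0 for 2 ≤ x ≤ 10⁸» [RS])] -/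
theorem init3_inv : Inv init3 := by
  have hE := MertensSecondChain.initE_inv
  obtain ⟨hmem, hprime, h3, hLlo0, hLlo, hLhi, hLL, -, -⟩ := hE
  have h3log := KernelLog.logIv_sound logIv_three
  have e3 : ((3 : ℕ) : ℝ) = 3 := by norm_num
  have elo : ((1328140761516560292552947 : ℤ) : ℝ) = 1328140761516560292552947 := by norm_num
  rw [e3, elo] at h3log
  have h80 : (0 : ℝ) < 2 ^ 80 := by positivity
  have hset : Nat.primesLE 3 = {2, 3} := by decide
  have hsum3 : ∑ q ∈ Nat.primesLE 3, Real.log ((1 - (q : ℝ)⁻¹)⁻¹) = Real.log 3 := by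
    rw [hset, Finset.sum_insert (by decide), Finset.sum_singleton]
    push_cast
    rw [← Real.log_mul (by norm_num) (by norm_num)]
    norm_num
  refine ⟨hmem, hprime, h3, hLlo0, hLlo, hLhi, hLL, ?_, ?_⟩
  · simp only [init3]
    rw [hsum3]
    push_cast
    have := h3log.1; rw [div_le_iff₀ h80] at this; linarith
  · intro x hx hx3
    simp only [init3] at hx3
    push_cast at hx3
    linarith

/-! ### §4 `E₃ > 0` below `358 811` -/

/-- The invariant after chunk 1 (prime `167953`). [cite: Zhao2025MertensMean, §1.1 («E_i(x) > 0 for 2 ≤ x ≤ 10⁸» [RS])] -/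
theorem inv_run1 :
    Inv ⟨167953, 14545117807108278801555194, 14545117807108754407928708,
        3007230998018183245836188, 3705232068526178659298518⟩ :=
  runD_sound init3_inv run1

/-- The invariant after chunk 2 (prime `358811`). [cite: Zhao2025MertensMean, §1.1 («E_i(x) > 0 for 2 ≤ x ≤ 10⁸» [RS])] -/
theorem inv_run2 :
    Inv ⟨358811, 15462827431324419163683070, 15462827431324894770484816,
        3081197337989921023099944, 3779223283082173560324696⟩ :=
  runD_sound inv_run1 run2

/-- **`γ + log log x < Σ_{q ≤ x} log((1 − 1/q)⁻¹)` for every real `3 ≤ x < 358811`** (the chain's claim at its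
final state, `γ < GHI/2⁸⁰`). [cite: Zhao2025MertensMean, §1.1 («E_i(x) > 0 for 2 ≤ x ≤ 10⁸» [RS])] -/
theorem eulerMascheroni_add_loglog_lt_sum {x : ℝ} (h3 : 3 ≤ x) (hx : x < 358811) :
    Real.eulerMascheroniConstant + Real.log (Real.log x) <
      ∑ q ∈ Nat.primesLE ⌊x⌋₊, Real.log ((1 - (q : ℝ)⁻¹)⁻¹) := by
  have h := inv_run2.claim x h3 (by simpa using hx)
  have hγ := Real.eulerMascheroniConstant_lt_d8
  have hG : (0.57721571 : ℝ) ≤ ((GHI : ℕ) : ℝ) / 2 ^ 80 := by norm_num [GHI]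
  linarith

end MertensThirdChain

/-- **`E₃(x) > 0` for `2 ≤ x < 358811`**, unconditionally, by the kernel certificate: `∏_{p ≤ x}(1 − 1/p)⁻¹ =
exp Σ_{p ≤ x} log((1 − 1/p)⁻¹) > e^γ log x` on `[3, 358811)`; on `[2, 3)`, `∏ = 2 > e^γ log 3`
(`E₃(x) = (log x)⁻¹∏_{p≤x}(1 − 1/p)⁻¹ − e^γ`, `Zhao2025.E₃`; Rosser–Schoenfeld Thm 23: `E₃ > 0` up to `10⁸`).
[cite: Zhao2025MertensMean, §1.1 («E_i(x) > 0 for 2 ≤ x ≤ 10⁸» [RS]); §4] -/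
theorem Zhao2025.E₃_pos_of_lt {x : ℝ} (h2 : 2 ≤ x) (hx : x < 358811) : 0 < Zhao2025.E₃ x := by
  have hx0 : 0 < x := by linarith
  have hlogx : 0 < Real.log x := Real.log_pos (by linarith)
  have hγ := Real.eulerMascheroniConstant_lt_d8
  unfold Zhao2025.E₃
  rw [sub_pos, lt_div_iff₀ hlogx]
  -- each factor is positive
  have hfac : ∀ q ∈ Nat.primesLE ⌊x⌋₊, 0 < (1 - (q : ℝ)⁻¹)⁻¹ := by
    intro q hq
    have hq2 : (2 : ℝ) ≤ q := by
      have := (Nat.mem_primesLE.1 hq).2.two_le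
      exact_mod_cast this
    have : (q : ℝ)⁻¹ ≤ 1 / 2 := by
      rw [inv_le_comm₀ (by linarith) (by norm_num)]; norm_num; exact_mod_cast hq2
    have : 0 < 1 - (q : ℝ)⁻¹ := by linarith
    positivity
  have hprod : ∏ q ∈ Nat.primesLE ⌊x⌋₊, (1 - (q : ℝ)⁻¹)⁻¹ =
      Real.exp (∑ q ∈ Nat.primesLE ⌊x⌋₊, Real.log ((1 - (q : ℝ)⁻¹)⁻¹)) := by
    rw [Real.exp_sum]
    exact Finset.prod_congr rfl fun q hq => (Real.exp_log (hfac q hq)).symm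
  rcases lt_or_ge x 3 with hx3 | hx3
  · -- `[2, 3)`: the product is `2`, and `e^γ log x < e^γ log 3 < 2`
    have hfl : ⌊x⌋₊ = 2 := by
      rw [Nat.floor_eq_iff hx0.le]
      exact ⟨by exact_mod_cast h2, by norm_num; linarith⟩
    rw [hfl, Mertens.primesLE_two, Finset.prod_singleton]
    have hl3 : Real.log x < Real.log 3 := Real.log_lt_log hx0 hx3
    have hlog3 : Real.log 3 < 1.0987 := by
      have h := KernelLog.logIv_sound (n := 3) (lo := 1328140761516560292552947)
        (hi := 1328140761517035898327275) (by decide +kernel)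
      have e3 : ((3 : ℕ) : ℝ) = 3 := by norm_num
      rw [e3] at h
      have : ((1328140761517035898327275 : ℤ) : ℝ) / 2 ^ 80 < 1.0987 := by norm_num
      linarith [h.2]
    have hexp : Real.exp Real.eulerMascheroniConstant < 1.8 := by
      have h1 : Real.exp Real.eulerMascheroniConstant ≤ Real.exp 0.57721571 := Real.exp_le_exp.2 hγ.le
      have h2 : Real.exp (0.57721571 : ℝ) < 1.8 := by
        have := Real.exp_bound' (x := 0.57721571) (by norm_num) (by norm_num) (n := 8) (by norm_num)
        -- crude: exp y ≤ Σ_{k<8} y^k/k! + y^8 (8+1)/(8! 8)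
        norm_num [Finset.sum_range_succ, Nat.factorial] at this
        linarith
      linarith
    have hpos : 0 < Real.exp Real.eulerMascheroniConstant := Real.exp_pos _
    push_cast
    nlinarith
  · have h := MertensThirdChain.eulerMascheroni_add_loglog_lt_sum hx3 hx
    rw [hprod]
    calc Real.exp Real.eulerMascheroniConstant * Real.log x
        = Real.exp (Real.eulerMascheroniConstant + Real.log (Real.log x)) := by
          rw [Real.exp_add, Real.exp_log hlogx]
      _ < Real.exp (∑ q ∈ Nat.primesLE ⌊x⌋₊, Real.log ((1 - (q : ℝ)⁻¹)⁻¹)) := Real.exp_lt_exp.2 h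

end Literature.NumberTheory.LFunctions

end
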